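import Summits.Ventures.YMGap.Census.PatternMonotone
import Literature.MathematicalPhysics.QuantumFieldTheory.VortexTwistCohomology
import HarnessLib

/-!
# Venture YMGap, track (b) — twisted character coefficient FIELDS: the dictionary `Z⁻ = Z(twisted field)`,
# Tomboulis's mod-2 rule for fields, and the even-sector expansion of `Z(a) + Z(a⁻)`

HONEST FRAMING: venture file of the cell `pub-ymgap` (QuantumFields programme), track (b); finite tori `(ℤ/Lℤ)^d` only;
nothing about Tomboulis's (5.15), limits, confinement or a mass gap.

Tomboulis, arXiv:0707.2179, App. A §2 proves Prop. IV.2 (monotonicity and the chessboard lower bound for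
`Z⁺ = (Z + Z⁻)/2`) from the representation (p. 21) `Z⁺ = ∫ dμ⁰ P⁺_𝒱 P⁺_{𝒱'}`, `𝒱'` "any other coclosed plaquette set
homologous to `𝒱`", i.e. from two facts: (a) the twist may be moved inside its homology class by the change of variables
`U_b ↦ -U_b` (§4, text after (4.1)), and (b) against a reflection the sum `Z + Z⁻` splits into non-negative pieces.  The
derivative `∂/∂c_k` of a partition function is a sum of MARKED partition functions — INHOMOGENEOUS character coefficient
fields (`FieldRP.coefFieldZ`) — so both facts are needed for fields, not only for the uniform coefficients of
`VortexTwistCohomology` / `TwistedSectorExpansion`.  This file supplies them: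

* `twistVec`, `twistField V a` (odd characters change sign on `V`); **dictionary** `torusZtw_eq_coefFieldZ_twistField`:
  `Z⁻_Λ({c_j}; V) = Z(twistField V (uniform stdCoef c))`.
* **Mod-2 rule for fields** `coefFieldZ_twistField_symmDiff_coboundary`: `Z(twistField (V ∆ δE) a) = Z(twistField V a)` for
  EVERY field `a` (Haar change of variables `flipLinks E` of `VortexTwistCohomology`; `χ_n(-U) = (-1)^n χ_n(U)`).
* **Even-sector expansion** `coefFieldZ_add_twist_eq_sum` (arXiv:0707.2179 App. A (A.17)–(A.18), field form):
  `Z(a) + Z(twistField V a) = 2 Σ_{Q ⊆ V, |Q| even} Z(sectorField V Q a)`, the `Q`-sector field carrying the odd characters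
  of `a_p` on `Q`, the even ones on `V ∖ Q`, and `a_p` off `V`.

References: E. T. Tomboulis, arXiv:0707.2179, §4 (text after (4.1)), App. A §2 and §5 (A.17)–(A.18)
[cite: Tomboulis2007Confinement, §4 and App. A]; K. Osterwalder, E. Seiler, Ann. Phys. 110 (1978) 440, §2
[cite: OsterwalderSeilerAnnPhys1978, §2].
-/

noncomputable section

open MeasureTheory Finset Real
open scoped BigOperators symmDiff
open Literature.MathematicalPhysics.QuantumLattice
open Literature.MathematicalPhysics.QuantumFieldTheory
open Literature.MathematicalPhysics.QuantumFieldTheory.Tomboulis2007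
open Literature.MathematicalPhysics.QuantumFieldTheory.WilsonRP

namespace Summit.Ventures.YMGap.Census

variable {d L : ℕ}

/-! ### Twisting a coefficient vector / a coefficient field -/

/-- The twisted coefficient vector: `(a⁻)_n = (-1)^n a_n` (only half-integer spins `n = 2j` odd change sign). -/
def twistVec (b : ℕ → ℝ) (n : ℕ) : ℝ := (-1 : ℝ) ^ n * b n

/-- The even-spin part of a coefficient vector (`n = 2j` even, including the constant term `n = 0`). -/
def evenPart (b : ℕ → ℝ) (n : ℕ) : ℝ := if Even n then b n else 0

/-- The odd-spin (half-integer `j`) part of a coefficient vector. -/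
def oddPart (b : ℕ → ℝ) (n : ℕ) : ℝ := if Even n then 0 else b n

/-- **The twisted field**: on the plaquettes of `V` the coefficient vector is twisted. -/
def twistField (V : Finset (Plaquette d L)) (a : Plaquette d L → ℕ → ℝ) : Plaquette d L → ℕ → ℝ :=
  fun p => if p ∈ V then twistVec (a p) else a p

/-- **The `Q`-sector field** of `a` relative to the twist set `V`: odd part on `Q`, even part on `V ∖ Q`, `a` off `V`. -/
def sectorField (V Q : Finset (Plaquette d L)) (a : Plaquette d L → ℕ → ℝ) : Plaquette d L → ℕ → ℝ :=
  fun p => if p ∈ V then (if p ∈ Q then oddPart (a p) else evenPart (a p)) else a p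

/-- Twisting twice does nothing. -/
theorem twistVec_twistVec (b : ℕ → ℝ) : twistVec (twistVec b) = b := by
  funext n
  unfold twistVec
  rw [← mul_assoc, ← mul_pow]
  norm_num

/-- `a = a^{even} + a^{odd}`. -/
theorem evenPart_add_oddPart (b : ℕ → ℝ) (n : ℕ) : evenPart b n + oddPart b n = b n := by
  unfold evenPart oddPart
  split_ifs <;> simp

/-- `a⁻ = a^{even} - a^{odd}`. -/
theorem evenPart_sub_oddPart (b : ℕ → ℝ) (n : ℕ) : evenPart b n - oddPart b n = twistVec b n := by
  unfold evenPart oddPart twistVec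
  split_ifs with h
  · rw [Even.neg_one_pow h]; ring
  · rw [Odd.neg_one_pow (Nat.not_even_iff_odd.1 h)]; ring

/-- The even part of a non-negative vector is non-negative. -/
theorem evenPart_nonneg {b : ℕ → ℝ} (hb : ∀ n, 0 ≤ b n) (n : ℕ) : 0 ≤ evenPart b n := by
  unfold evenPart; split_ifs; exacts [hb n, le_rfl]

/-- The odd part of a non-negative vector is non-negative. -/
theorem oddPart_nonneg {b : ℕ → ℝ} (hb : ∀ n, 0 ≤ b n) (n : ℕ) : 0 ≤ oddPart b n := by
  unfold oddPart; split_ifs; exacts [le_rfl, hb n]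

/-- Twisting on the empty set does nothing. -/
theorem twistField_empty (a : Plaquette d L → ℕ → ℝ) : twistField ∅ a = a := by
  funext p; simp [twistField]

/-- The twisted field on the twist set. -/
theorem twistField_of_mem {V : Finset (Plaquette d L)} {p : Plaquette d L} (hp : p ∈ V) (a : Plaquette d L → ℕ → ℝ) :
    twistField V a p = twistVec (a p) := by
  simp [twistField, hp]

/-- The twisted field off the twist set. -/
theorem twistField_of_not_mem {V : Finset (Plaquette d L)} {p : Plaquette d L} (hp : p ∉ V)
    (a : Plaquette d L → ℕ → ℝ) : twistField V a p = a p := by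
  simp [twistField, hp]

/-- Twisting commutes with replacing the coefficient vector of one plaquette. -/
theorem twistField_update (V : Finset (Plaquette d L)) (a : Plaquette d L → ℕ → ℝ) (p₀ : Plaquette d L) (b : ℕ → ℝ) :
    twistField V (Function.update a p₀ b) = Function.update (twistField V a) p₀ (twistField V (fun _ => b) p₀) := by
  funext p
  by_cases hp : p = p₀
  · subst hp; simp [twistField]
  · simp [twistField, Function.update_of_ne hp]

/-- The sector fields agree with the field off the twist set. -/
theorem sectorField_of_not_mem {V Q : Finset (Plaquette d L)} {p : Plaquette d L} (hp : p ∉ V)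
    (a : Plaquette d L → ℕ → ℝ) : sectorField V Q a p = a p := by
  simp [sectorField, hp]

/-- The sector fields of a non-negative field are non-negative. -/
theorem sectorField_nonneg (V Q : Finset (Plaquette d L)) {a : Plaquette d L → ℕ → ℝ} {p : Plaquette d L}
    (ha : ∀ n, 0 ≤ a p n) (n : ℕ) : 0 ≤ sectorField V Q a p n := by
  unfold sectorField
  split_ifs
  · exact oddPart_nonneg ha n
  · exact evenPart_nonneg ha n
  · exact ha n

/-! ### Character sums: linearity, the twisted sum, parity `χ_n(-r) = (-1)^n χ_n(r)` -/

/-- `charSum` is additive in the coefficient vector. -/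
theorem charSum_add (J : ℕ) (b₁ b₂ : ℕ → ℝ) (r : ℝ) :
    charSum J (fun n => b₁ n + b₂ n) r = charSum J b₁ r + charSum J b₂ r := by
  simp only [charSum, add_mul, Finset.sum_add_distrib]

/-- `charSum` respects subtraction of coefficient vectors. -/
theorem charSum_sub (J : ℕ) (b₁ b₂ : ℕ → ℝ) (r : ℝ) :
    charSum J (fun n => b₁ n - b₂ n) r = charSum J b₁ r - charSum J b₂ r := by
  simp only [charSum, sub_mul, Finset.sum_sub_distrib]

/-- `charSum` is homogeneous in the coefficient vector. -/
theorem charSum_smul (J : ℕ) (t : ℝ) (b : ℕ → ℝ) (r : ℝ) :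
    charSum J (fun n => t * b n) r = t * charSum J b r := by
  simp only [charSum, mul_assoc, Finset.mul_sum]

/-- `charSum a = charSum (even part) + charSum (odd part)`. -/
theorem charSum_eq_even_add_odd (J : ℕ) (b : ℕ → ℝ) (r : ℝ) :
    charSum J b r = charSum J (evenPart b) r + charSum J (oddPart b) r := by
  rw [← charSum_add]
  simp only [evenPart_add_oddPart]

/-- `charSum (twisted) = charSum (even part) - charSum (odd part)`. -/
theorem charSum_twistVec_eq_even_sub_odd (J : ℕ) (b : ℕ → ℝ) (r : ℝ) :
    charSum J (twistVec b) r = charSum J (evenPart b) r - charSum J (oddPart b) r := by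
  rw [← charSum_sub]
  simp only [evenPart_sub_oddPart]

/-- **Parity of the characters**: `χ_n(-r) = (-1)^n χ_n(r)` (Chebyshev `U_n(-x) = (-1)^n U_n(x)`). -/
theorem charR_neg (n : ℕ) (r : ℝ) : charR n (-r) = (-1 : ℝ) ^ n * charR n r := by
  unfold charR
  rw [neg_div, Polynomial.Chebyshev.U_eval_neg, Int.cast_negOnePow_natCast]

/-- `charSum a (-r) = charSum (twistVec a) r`. -/
theorem charSum_neg (J : ℕ) (b : ℕ → ℝ) (r : ℝ) : charSum J b (-r) = charSum J (twistVec b) r := by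
  simp only [charSum, charR_neg, twistVec]
  exact Finset.sum_congr rfl fun n _ => by ring

/-- **Dictionary for the twisted plaquette function**: `f⁻(U_p) = charSum (twistVec (stdCoef c)) (Re tr U_p)`. -/
theorem charSum_twistVec_stdCoef (J : ℕ) (c : ℕ → ℝ) (W : GaugeConfig d L SU2) (p : Plaquette d L) :
    charSum J (twistVec (stdCoef c)) (plaqRe rhoFund W p) = plaqFnTwist J c (plaquetteHolonomy W p.1 p.2.1.1 p.2.1.2) := by
  unfold charSum plaqFnTwist
  rw [sum_range_succ_eq_add_sum_Icc]
  congr 1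
  · simp [twistVec, stdCoef, charR_zero]
  · refine Finset.sum_congr rfl fun n hn => ?_
    have hn0 : n ≠ 0 := by have := (Finset.mem_Icc.1 hn).1; omega
    simp only [twistVec, stdCoef, hn0, if_false, su2Char_hol_eq_charR]
    ring

/-- **`Z⁻_Λ({c_j}; V) = Z(twistField V (uniform field))`.** -/
theorem torusZtw_eq_coefFieldZ_twistField [NeZero L] (J : ℕ) (c : ℕ → ℝ) (V : Finset (Plaquette d L)) :
    torusZtw d L J c V = coefFieldZ J (twistField V fun _ : Plaquette d L => stdCoef c) := by
  unfold torusZtw coefFieldZ coefFieldFn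
  refine integral_congr_ae (ae_of_all _ fun W => Finset.prod_congr rfl fun p _ => ?_)
  by_cases hp : p ∈ V
  · rw [if_pos hp, twistField_of_mem hp, charSum_twistVec_stdCoef]
  · rw [if_neg hp, twistField_of_not_mem hp, plaqFn_hol_eq_fR, charSum_stdCoef]

/-- `Z⁺ = (Z(a) + Z(twistField V a))/2` for the uniform field `a`. -/
theorem torusZplus_eq_coefFieldZ [NeZero L] (J : ℕ) (c : ℕ → ℝ) (V : Finset (Plaquette d L)) :
    torusZplus d L J c V = (coefFieldZ J (fun _ : Plaquette d L => stdCoef c) +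
      coefFieldZ J (twistField V fun _ : Plaquette d L => stdCoef c)) / 2 := by
  rw [torusZplus, torusZ_eq_coefFieldZ, torusZtw_eq_coefFieldZ_twistField]

/-! ### Tomboulis's mod-2 rule for fields: `Z(twistField (V ∆ δE) a) = Z(twistField V a)` -/

/-- `σ_E(e) = (-𝟙)^{𝟙_E(e)}` (plumbing, as in `VortexTwistCohomology`). -/
theorem linkSign_eq_negOne_pow (E : Finset (Edge d L)) (e : Edge d L) : linkSign E e = negOne ^ linkInd E e := by
  unfold linkSign linkInd
  split_ifs <;> simp

/-- The plaquette sign is `(-𝟙)^{k_p(E)}` (plumbing). -/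
theorem plaqSign_eq_negOne_pow (E : Finset (Edge d L)) (x : Site d L) (i j : Fin d) :
    plaqSign E x i j = negOne ^ flipCount E x i j := by
  simp only [plaqSign, flipCount, linkSign_eq_negOne_pow, pow_add]

/-- `(-𝟙)^k` is `𝟙` or `-𝟙` according to the parity of `k`. -/
theorem negOne_pow_eq (k : ℕ) : (negOne : SU2) ^ k = if Odd k then negOne else 1 := by
  rcases Nat.even_or_odd k with ⟨m, rfl⟩ | ⟨m, rfl⟩
  · rw [if_neg (by simp [← two_mul]), ← two_mul, pow_mul, pow_two, negOne_mul_negOne, one_pow]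
  · rw [if_pos ⟨m, rfl⟩, pow_succ, pow_mul, pow_two, negOne_mul_negOne, one_pow, one_mul]

/-- **A character sum of a flipped configuration**: under `U_b ↦ -U_b` (`b ∈ E`) the weight of the plaquette `p` becomes
the weight of the TWISTED coefficient vector if `p ∈ δE`, and is unchanged otherwise. -/
theorem charSum_plaqRe_flipLinks [NeZero L] (J : ℕ) (b : ℕ → ℝ) (E : Finset (Edge d L)) (W : GaugeConfig d L SU2)
    (p : Plaquette d L) :
    charSum J b (plaqRe rhoFund (flipLinks E W) p) =
      if p ∈ coboundary E then charSum J (twistVec b) (plaqRe rhoFund W p) else charSum J b (plaqRe rhoFund W p) := by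
  have hhol : plaquetteHolonomy (flipLinks E W) p.1 p.2.1.1 p.2.1.2 =
      (if Odd (flipCount E p.1 p.2.1.1 p.2.1.2) then negOne else 1) * plaquetteHolonomy W p.1 p.2.1.1 p.2.1.2 := by
    rw [plaquetteHolonomy_flipLinks, plaqSign_eq_negOne_pow, negOne_pow_eq]
  by_cases hodd : Odd (flipCount E p.1 p.2.1.1 p.2.1.2)
  · rw [if_pos ((mem_coboundary E p).2 hodd)]
    unfold charSum
    refine Finset.sum_congr rfl fun n _ => ?_
    rw [← su2Char_hol_eq_charR, ← su2Char_hol_eq_charR, hhol, if_pos hodd, su2Char_negOne_mul, twistVec]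
    ring
  · rw [if_neg (fun h => hodd ((mem_coboundary E p).1 h))]
    unfold charSum
    refine Finset.sum_congr rfl fun n _ => ?_
    rw [← su2Char_hol_eq_charR, ← su2Char_hol_eq_charR, hhol, if_neg hodd, one_mul]

/-- **Tomboulis's mod-2 rule, FIELD form** (arXiv:0707.2179 §4, text after (4.1): the twist "can be moved to … any other
homologous coclosed set `𝒱'` by the change of variables `U_b → -U_b` for each bond `b` in a set of bonds cobounded by
`𝒱 ∪ 𝒱'`"): for EVERY coefficient field `a`, every plaquette set `V` and every link set `E`,
`Z(twistField (V ∆ δE) a) = Z(twistField V a)`.  No hypothesis on `a`, `J`, `d`, `L`. -/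
theorem coefFieldZ_twistField_symmDiff_coboundary [NeZero L] (J : ℕ) (a : Plaquette d L → ℕ → ℝ)
    (V : Finset (Plaquette d L)) (E : Finset (Edge d L)) :
    coefFieldZ J (twistField (V ∆ coboundary E) a) = coefFieldZ J (twistField V a) := by
  have hmp : MeasurePreserving (flipEquiv E) (LatticeRP.piMeasure (haarProbability SU2))
      (LatticeRP.piMeasure (haarProbability SU2)) := measurePreserving_flipLinks E
  unfold coefFieldZ
  refine Eq.trans ?_ (hmp.integral_comp' (coefFieldFn J (twistField V a)))
  refine integral_congr_ae (ae_of_all _ fun W => ?_)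
  change coefFieldFn J (twistField (V ∆ coboundary E) a) W = coefFieldFn J (twistField V a) (flipLinks E W)
  unfold coefFieldFn
  refine Finset.prod_congr rfl fun p _ => ?_
  rw [charSum_plaqRe_flipLinks]
  by_cases hV : p ∈ V <;> by_cases hE : p ∈ coboundary E
  · have h : p ∉ V ∆ coboundary E := by rw [Finset.mem_symmDiff]; tauto
    rw [twistField_of_not_mem h, if_pos hE, twistField_of_mem hV, twistVec_twistVec]
  · have h : p ∈ V ∆ coboundary E := Finset.mem_symmDiff.2 (Or.inl ⟨hV, hE⟩)
    rw [twistField_of_mem h, if_neg hE, twistField_of_mem hV]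
  · have h : p ∈ V ∆ coboundary E := Finset.mem_symmDiff.2 (Or.inr ⟨hE, hV⟩)
    rw [twistField_of_mem h, if_pos hE, twistField_of_not_mem hV]
  · have h : p ∉ V ∆ coboundary E := by rw [Finset.mem_symmDiff]; tauto
    rw [twistField_of_not_mem h, if_neg hE, twistField_of_not_mem hV]

/-- The mod-2 rule in its symmetric form: `V ∆ W = δE ⟹ Z(twistField V a) = Z(twistField W a)`. -/
theorem coefFieldZ_twistField_congr_coboundary [NeZero L] (J : ℕ) (a : Plaquette d L → ℕ → ℝ)
    {V W : Finset (Plaquette d L)} (E : Finset (Edge d L)) (h : V ∆ W = coboundary E) :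
    coefFieldZ J (twistField V a) = coefFieldZ J (twistField W a) := by
  have hW : W = V ∆ coboundary E := by
    rw [← h, ← symmDiff_assoc, symmDiff_self, bot_symmDiff]
  rw [hW, coefFieldZ_twistField_symmDiff_coboundary]

/-! ### The even-sector expansion of `Z(a) + Z(twistField V a)` -/

section Sector

variable [NeZero L]

/-- `∏_{i ∈ t} (-g i) = (-1)^{#t} ∏_{i ∈ t} g i` (plumbing). -/
theorem prod_neg_eq_pow_mul {ι : Type*} (t : Finset ι) (g : ι → ℝ) :
    ∏ i ∈ t, (-g i) = (-1 : ℝ) ^ t.card * ∏ i ∈ t, g i := by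
  rw [← Finset.prod_const, ← Finset.prod_mul_distrib]
  exact Finset.prod_congr rfl fun i _ => by ring

/-- **The sector expansion, pointwise** (arXiv:0707.2179 App. A (A.17)–(A.18) for fields): with `E_p`, `O_p` the even and
odd parts of the weight of `p ∈ V`,
`∏_p w_p + ∏_p w⁻_p = G · (∏_{p∈V}(E_p + O_p) + ∏_{p∈V}(E_p - O_p)) = 2 Σ_{Q ⊆ V, |Q| even} (Q-sector integrand)`. -/
theorem coefFieldFn_add_twist_eq_sum (J : ℕ) (V : Finset (Plaquette d L)) (a : Plaquette d L → ℕ → ℝ)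
    (W : GaugeConfig d L SU2) :
    coefFieldFn J a W + coefFieldFn J (twistField V a) W =
      2 * ∑ Q ∈ V.powerset.filter (fun Q => Even Q.card), coefFieldFn J (sectorField V Q a) W := by
  -- abbreviations
  set r : Plaquette d L → ℝ := fun p => plaqRe rhoFund W p with hr
  set Ev : Plaquette d L → ℝ := fun p => charSum J (evenPart (a p)) (r p) with hEv
  set Od : Plaquette d L → ℝ := fun p => charSum J (oddPart (a p)) (r p) with hOd
  set G : ℝ := ∏ p ∈ univ.filter (fun p => p ∉ V), charSum J (a p) (r p) with hG
  have hVf : univ.filter (fun p : Plaquette d L => p ∈ V) = V := by ext p; simp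
  -- the three products split off `G`
  have h1 : coefFieldFn J a W = (∏ p ∈ V, (Od p + Ev p)) * G := by
    unfold coefFieldFn
    rw [← Finset.prod_filter_mul_prod_filter_not univ (fun p => p ∈ V), hVf]
    congr 1
    exact Finset.prod_congr rfl fun p _ => by rw [charSum_eq_even_add_odd, add_comm]
  have h2 : coefFieldFn J (twistField V a) W = (∏ p ∈ V, (-Od p + Ev p)) * G := by
    unfold coefFieldFn
    rw [← Finset.prod_filter_mul_prod_filter_not univ (fun p => p ∈ V), hVf]
    congr 1
    · exact Finset.prod_congr rfl fun p hp => by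
        rw [twistField_of_mem hp, charSum_twistVec_eq_even_sub_odd]; ring
    · exact Finset.prod_congr rfl fun p hp => by rw [twistField_of_not_mem (Finset.mem_filter.1 hp).2]
  have h3 : ∀ Q ∈ V.powerset, coefFieldFn J (sectorField V Q a) W = ((∏ p ∈ Q, Od p) * ∏ p ∈ V \ Q, Ev p) * G := by
    intro Q hQ
    have hQV : Q ⊆ V := Finset.mem_powerset.1 hQ
    unfold coefFieldFn
    rw [← Finset.prod_filter_mul_prod_filter_not univ (fun p => p ∈ V), hVf]
    congr 1
    · rw [← Finset.prod_sdiff hQV, mul_comm]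
      congr 1
      · exact Finset.prod_congr rfl fun p hp => by
          simp only [sectorField, hQV hp, hp, if_true, hOd, hr]
      · exact Finset.prod_congr rfl fun p hp => by
          simp only [sectorField, (Finset.mem_sdiff.1 hp).1, (Finset.mem_sdiff.1 hp).2, if_true, if_false, hEv, hr]
    · exact Finset.prod_congr rfl fun p hp => by rw [sectorField_of_not_mem (Finset.mem_filter.1 hp).2]
  rw [h1, h2, ← add_mul, Finset.prod_add, Finset.prod_add, ← Finset.sum_add_distrib]
  have h4 : ∀ Q ∈ V.powerset, (∏ p ∈ Q, Od p) * (∏ p ∈ V \ Q, Ev p) + (∏ p ∈ Q, -Od p) * ∏ p ∈ V \ Q, Ev p =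
      (if Even Q.card then 2 else 0) * ((∏ p ∈ Q, Od p) * ∏ p ∈ V \ Q, Ev p) := by
    intro Q _
    rw [prod_neg_eq_pow_mul]
    split_ifs with hQ
    · rw [Even.neg_one_pow hQ]; ring
    · rw [Odd.neg_one_pow (Nat.not_even_iff_odd.1 hQ)]; ring
  rw [Finset.sum_congr rfl h4, Finset.sum_mul, Finset.mul_sum, Finset.sum_filter]
  refine Finset.sum_congr rfl fun Q hQ => ?_
  rw [h3 Q hQ]
  split_ifs <;> ring

/-- **The even-sector expansion of `Z(a) + Z(a⁻)`** (integrated form). -/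
theorem coefFieldZ_add_twist_eq_sum (J : ℕ) (V : Finset (Plaquette d L)) (a : Plaquette d L → ℕ → ℝ) :
    coefFieldZ J a + coefFieldZ J (twistField V a) =
      2 * ∑ Q ∈ V.powerset.filter (fun Q => Even Q.card), coefFieldZ J (sectorField V Q a) := by
  haveI : SecondCountableTopology SU2 := secondCountableTopology_su2
  unfold coefFieldZ
  rw [← integral_add (integrable_of_continuous_fin (continuous_coefFieldFn J _))
      (integrable_of_continuous_fin (continuous_coefFieldFn J _)),
    ← integral_finsetSum _ (fun Q _ => integrable_of_continuous_fin (continuous_coefFieldFn J _)),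
    ← integral_const_mul]
  exact integral_congr_ae (ae_of_all _ fun W => coefFieldFn_add_twist_eq_sum J V a W)

end Sector

/-! ### Reflection positivity of `Z(a) + Z(a⁻)` for a twist set ON the reflection hyperplane, and of `Z(a⁻)` for a
reflection-invariant twist set OFF it -/

section RP

variable [NeZero d] [NeZero L] [Fact (1 < L)]

/-- **Case A — bisected twist set** (arXiv:0707.2179 App. A §5/§2): if every plaquette of `V` is a crossing plaquette,
the field `a` is mirror-symmetric off the crossing plaquettes and non-negative on them, then
`0 ≤ Z(a) + Z(twistField V a)` (every even sector is `≥ 0` by `FieldRP.coefFieldZ_nonneg`). -/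
theorem coefFieldZ_add_twist_nonneg_of_cross (hL : Even L) (J : ℕ) {a : Plaquette d L → ℕ → ℝ}
    {V : Finset (Plaquette d L)} (hV : ∀ p ∈ V, IsCrossPlaq p)
    (ha : ∀ p, ¬ IsCrossPlaq p → a (plaqReflect p) = a p) (hpos : ∀ p, IsCrossPlaq p → ∀ n, 0 ≤ a p n) :
    0 ≤ coefFieldZ J a + coefFieldZ J (twistField V a) := by
  rw [coefFieldZ_add_twist_eq_sum]
  refine mul_nonneg zero_le_two (Finset.sum_nonneg fun Q _ => coefFieldZ_nonneg hL J (fun p hp => ?_) fun p hp n => ?_)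
  · have hp' : ¬ IsCrossPlaq (plaqReflect p) := not_isCrossPlaq_plaqReflect hL hp
    rw [sectorField_of_not_mem (fun h => hp (hV p h)), sectorField_of_not_mem (fun h => hp' (hV _ h)), ha p hp]
  · exact sectorField_nonneg V Q (hpos p hp) n

/-- **Case B — twist set parallel to the hyperplanes**: if `V` contains no crossing plaquette and is invariant under the
reflection of plaquettes, then the twisted field inherits mirror symmetry and positivity from `a`, so
`0 ≤ Z(twistField V a)` by `FieldRP.coefFieldZ_nonneg` directly. -/
theorem coefFieldZ_twist_nonneg_of_reflect (hL : Even L) (J : ℕ) {a : Plaquette d L → ℕ → ℝ}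
    {V : Finset (Plaquette d L)} (hVc : ∀ p ∈ V, ¬ IsCrossPlaq p)
    (hVr : ∀ p, ¬ IsCrossPlaq p → (plaqReflect p ∈ V ↔ p ∈ V))
    (ha : ∀ p, ¬ IsCrossPlaq p → a (plaqReflect p) = a p) (hpos : ∀ p, IsCrossPlaq p → ∀ n, 0 ≤ a p n) :
    0 ≤ coefFieldZ J (twistField V a) := by
  refine coefFieldZ_nonneg hL J (fun p hp => ?_) fun p hp n => ?_
  · by_cases hpV : p ∈ V
    · rw [twistField_of_mem hpV, twistField_of_mem ((hVr p hp).2 hpV), ha p hp]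
    · rw [twistField_of_not_mem hpV, twistField_of_not_mem (fun h => hpV ((hVr p hp).1 h)), ha p hp]
  · rw [twistField_of_not_mem (fun h => hVc p h hp)]
    exact hpos p hp n

end RP

end Summit.Ventures.YMGap.Census

end
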